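import Summits.ResolutionOfSingularities.ResolutionOfSingularities.Theorems.PurelyInseparableDim4ColengthCert
import Summits.ResolutionOfSingularities.ResolutionOfSingularities.Theorems.PurelyInseparableDim4NarrowApolarity
import Summits.ResolutionOfSingularities.ResolutionOfSingularities.Theorems.PurelyInseparableDim4HeightBudgetFalse
import Mathlib.LinearAlgebra.Matrix.ToLin
import HarnessLib

/-!
# A `decide`-able certificate kit for the DIRECTRIX LETTER `ē` (cell `res-dim4-pi`, seat res-dim4-p-8 g2)

[OURS · counted 0 · instrument] Nothing here is a statement about resolution of singularities; resolution in
dimension `≥ 4` / characteristic `p > 0` is NOT proved by anything in this file.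

`ē(F) = dim_K A(in F)` (`RidgeBudget.ebar`, the tree's `PointBlowup.additiveSubspace` = kernel of the polar map
of the initial form) is the letter separating the NARROW (`ē = 1`, `RidgeBudget.narrowDrop`) from the WIDE
(`ē = 2`, the open core `NoWideTrap 3 3`) floor regime.  By res-dim4-p-1 g2's apolarity
(`NarrowApolarity.mem_additiveSubspace_iff_forall`), at a state of order exactly `q` the subspace `A(in F)` is the
common kernel of the finitely many linear forms `ℓ_β(v) = Σᵢ vᵢ · coeff_{β+eᵢ}(F) · (βᵢ + 1)`, `|β| = q − 1`.
This makes both inequalities on `ē` CHECKABLE on presented states (`StepKit.Terms`), over any field with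
decidable equality (`𝔽_p` literals, `decide +kernel`):

* §1 `polarRow L β` (the coefficient vector of `ℓ_β`), `dotV`, `ordB q L` (`ord₀ = q` on the list) and
  transfers;
* §2 **`ebarGeB q L V W`** — `V` = `k` vectors killed by every `ℓ_β`, `W` = `k` vectors with
  `⟨Vᵢ, Wⱼ⟩ = δᵢⱼ` (so `V` is linearly independent) — and **`length_le_ebar_of_ebarGeB : … → V.length ≤ ebar`**;
* §3 **`ebarLeB q L B D`** — `B` = `n` multi-indices of degree `q − 1`, `D` = `n` vectors with
  `ℓ_{Bᵢ}(Dⱼ) = δᵢⱼ` (so the `n` forms are independent and `A ≤ ⋂ ker ℓ_{Bᵢ}` has dimension `≤ 4 − n`) — and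
  **`ebar_add_length_le_of_ebarLeB : … → ebar + B.length ≤ 4`**; `ebar_eq_of_certs`.
* §4 acceptance rows: `ē` along the H1 chain of res-dim4-p-12 g2's `…HeightBudgetFalse` (crit-4's specimen):
  `ebar_H1_0 … ebar_H1_5` = `2, 1, 1, 1, 1, 0` ‖ K — one wide edge `c₀ → c₁` (where μ⁺ stayed 5), then the
  narrow staircase of `RidgeBudget.narrowDrop`, ending at `ē = 0` with `μ⁺ = 1`.
`e_G` rows for res-dim4-p-12 g2's `ResCone.resVertex` follow on `r = 0` states by his `finrank_resVertex_eq_ebar`.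
bears_on: LADDER-RESOLUTION:D157-DOOR2 (res-dim4-pi · F4-I(3,3) wide/narrow letters · ē rows ‖ K).
Supports stmt-ResolutionOfSingularities-16155 (helper).
-/

set_option linter.dupNamespace false -- mandated namespace of this single-conjunct summit

noncomputable section

open MvPolynomial Finset
open scoped BigOperators

namespace Summit.ResolutionOfSingularities.ResolutionOfSingularities.Theorems.PIDim4

namespace EbarCert

open StepKit ColengthCert
open Literature.AlgebraicGeometry.Resolution
open Literature.AlgebraicGeometry.Resolution.CentreBlowup
open Literature.AlgebraicGeometry.Resolution.Hauser2010
open Literature.AlgebraicGeometry.Resolution.HauserPerlega2019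
open PointBlowup (additiveSubspace)

variable {K : Type} [Field K] [DecidableEq K]

/-! ## §1 The polar rows on term lists -/

omit [Field K] [DecidableEq K] in
/-- The value function of `expo e` is `e`. [folklore] -/
theorem coe_expo (e : Fin 4 → ℕ) : ⇑(StepKit.expo e) = e := funext fun i => expo_apply e i

/-- The coefficient vector of the linear form `ℓ_β(v) = Σᵢ vᵢ · coeff_{β+eᵢ}(F) · (βᵢ + 1)`, read on the
term list. [folklore] -/
def polarRow (L : Terms 4 K) (β : Fin 4 → ℕ) : Fin 4 → K :=
  fun i => coeffAt L (Function.update β i (β i + 1)) * ((β i : K) + 1)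

/-- Dot product on `K⁴`. [folklore] -/
def dotV (u v : Fin 4 → K) : K := ∑ i, u i * v i

/-- `ord₀ (evalT L) = q` as a Boolean check. [folklore] -/
def ordB (q : ℕ) (L : Terms 4 K) : Bool := decide (infList ((live L).map fun e => ∑ i, e i) = (q : ℕ∞))

/-- Transfer of `ordB`. [folklore] -/
theorem ordZero_of_ordB {q : ℕ} {L : Terms 4 K} (h : ordB q L = true) : ordZero (evalT L) = q := by
  rw [ordZero_evalT]; simpa [ordB] using h

omit [DecidableEq K] in
/-- `β + eᵢ` on value functions. [folklore] -/
theorem coe_add_single (β : Fin 4 →₀ ℕ) (i : Fin 4) :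
    ⇑(β + Finsupp.single i 1 : Fin 4 →₀ ℕ) = Function.update (⇑β) i (β i + 1) := by
  funext l
  rw [Finsupp.add_apply, Function.update_apply]
  by_cases h : l = i
  · subst h; rw [Finsupp.single_eq_same, if_pos rfl]
  · rw [Finsupp.single_eq_of_ne h, if_neg h, add_zero]

omit [DecidableEq K] in
/-- **Transfer of the polar rows**: at order exactly `q`, `v ∈ A(in (evalT L))` iff `⟨v, polarRow L β⟩ = 0` for
every `β` of degree `q − 1` (res-dim4-p-1 g2's apolarity, read on the list). [folklore] -/
theorem mem_additiveSubspace_iff_polarRow {q : ℕ} {L : Terms 4 K} (hord : ordZero (evalT L) = q)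
    (v : Fin 4 → K) :
    v ∈ additiveSubspace (initialForm (evalT L)) ↔
      ∀ β : Fin 4 →₀ ℕ, β.degree + 1 = q → dotV v (polarRow L ⇑β) = 0 := by
  rw [NarrowApolarity.mem_additiveSubspace_iff_forall hord]
  refine forall_congr' fun β => forall_congr' fun _ => ?_
  rw [dotV]
  refine Eq.congr (Finset.sum_congr rfl fun i _ => ?_) rfl
  rw [polarRow, coeff_evalT, coe_add_single]

/-- A vector killed by all listed polar rows of degree `q − 1` lies in `A(in F)` (`q ≥ 1`). [folklore] -/
theorem mem_additiveSubspace_of_all {q : ℕ} (hq : 1 ≤ q) {L : Terms 4 K} (hord : ordZero (evalT L) = q)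
    {v : Fin 4 → K} (h : ((monosN (q - 1)).all fun β => decide (dotV v (polarRow L β) = 0)) = true) :
    v ∈ additiveSubspace (initialForm (evalT L)) := by
  rw [mem_additiveSubspace_iff_polarRow hord]
  intro β hβ
  simp only [List.all_eq_true, decide_eq_true_eq] at h
  exact h (⇑β) (mem_monosN (by omega))

/-! ## §2 Lower bounds: `k` independent vectors of `A(in F)` -/

/-- **Lower-bound certificate**: `ord₀ = q`, every vector of `V` is killed by every polar row of degree `q − 1`,
and `W` is a dual family: `⟨Vᵢ, Wⱼ⟩ = δᵢⱼ`. [folklore] -/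
def ebarGeB (q : ℕ) (L : Terms 4 K) (V W : List (Fin 4 → K)) : Bool :=
  decide (1 ≤ q) && ordB q L && decide (V.length = W.length) &&
    (V.all fun v => (monosN (q - 1)).all fun β => decide (dotV v (polarRow L β) = 0)) &&
    decide (∀ i j : Fin V.length, dotV (V.get i) (W.getD j 0) = if i = j then 1 else 0)

/-- **Soundness of the lower-bound certificate**: `V.length ≤ ē(evalT L)`. [folklore] -/
theorem length_le_ebar_of_ebarGeB {q : ℕ} {L : Terms 4 K} {V W : List (Fin 4 → K)}
    (h : ebarGeB q L V W = true) : V.length ≤ RidgeBudget.ebar (evalT L) := by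
  simp only [ebarGeB, Bool.and_eq_true, decide_eq_true_eq, List.all_eq_true] at h
  obtain ⟨⟨⟨⟨hq, hordB⟩, _⟩, hmem⟩, hdual⟩ := h
  have hord := ordZero_of_ordB hordB
  set A := additiveSubspace (initialForm (evalT L)) with hA
  -- the family of certified vectors, valued in `A`
  have hVmem : ∀ i : Fin V.length, V.get i ∈ A := fun i =>
    mem_additiveSubspace_of_all hq hord (by
      simp only [List.all_eq_true, decide_eq_true_eq]
      exact fun β hβ => by simpa using hmem (V.get i) (List.get_mem V i) β hβ)
  let f : Fin V.length → A := fun i => ⟨V.get i, hVmem i⟩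
  have hli : LinearIndependent K f := by
    rw [Fintype.linearIndependent_iff]
    intro g hg j
    have hsum : (∑ i, g i • V.get i) = (0 : Fin 4 → K) := by
      have := congrArg (fun x : A => (x : Fin 4 → K)) hg
      simpa [f] using this
    -- pair with `W j`
    have hpair := congrArg (fun u : Fin 4 → K => dotV u (W.getD j 0)) hsum
    have hzero : dotV (0 : Fin 4 → K) (W.getD j 0) = 0 := by simp [dotV]
    have hlin : dotV (∑ i, g i • V.get i) (W.getD j 0) = ∑ i, g i * dotV (V.get i) (W.getD j 0) := by
      simp only [dotV, Finset.sum_apply, Pi.smul_apply, smul_eq_mul, Finset.sum_mul, Finset.mul_sum]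
      rw [Finset.sum_comm]
      exact Finset.sum_congr rfl fun i _ => Finset.sum_congr rfl fun l _ => by ring
    simp only [hlin, hzero] at hpair
    simp only [hdual, mul_ite, mul_one, mul_zero, Finset.sum_ite_eq', Finset.mem_univ, if_true] at hpair
    exact hpair
  have h2 := hli.fintype_card_le_finrank
  rw [Fintype.card_fin] at h2
  unfold RidgeBudget.ebar
  rw [← hA]
  exact h2

/-! ## §3 Upper bounds: `n` independent polar rows -/

/-- **Upper-bound certificate**: `ord₀ = q`, the listed multi-indices `B` all have degree `q − 1`, and `D` is a
dual family for the rows: `ℓ_{Bᵢ}(Dⱼ) = δᵢⱼ`. [folklore] -/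
def ebarLeB (q : ℕ) (L : Terms 4 K) (B : List (Fin 4 → ℕ)) (D : List (Fin 4 → K)) : Bool :=
  ordB q L && decide (B.length = D.length) && (B.all fun β => decide (∑ i, β i + 1 = q)) &&
    decide (∀ i j : Fin B.length, dotV (D.getD j 0) (polarRow L (B.get i)) = if i = j then 1 else 0)

/-- The evaluation map `v ↦ (ℓ_{Bᵢ}(v))ᵢ` as a linear map `K⁴ → K^n`. [folklore] -/
def rowMap (L : Terms 4 K) (B : List (Fin 4 → ℕ)) : (Fin 4 → K) →ₗ[K] (Fin B.length → K) :=
  Matrix.mulVecLin (Matrix.of fun (i : Fin B.length) (l : Fin 4) => polarRow L (B.get i) l)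

omit [DecidableEq K] in
/-- `rowMap` computes the dot products with the rows. [folklore] -/
theorem rowMap_apply (L : Terms 4 K) (B : List (Fin 4 → ℕ)) (v : Fin 4 → K) (i : Fin B.length) :
    rowMap L B v i = dotV v (polarRow L (B.get i)) := by
  rw [rowMap, Matrix.mulVecLin_apply, Matrix.mulVec, dotV]
  change ∑ l, polarRow L (B.get i) l * v l = _
  exact Finset.sum_congr rfl fun l _ => mul_comm _ _

/-- **Soundness of the upper-bound certificate**: `ē(evalT L) + B.length ≤ 4`. [folklore] -/
theorem ebar_add_length_le_of_ebarLeB {q : ℕ} {L : Terms 4 K} {B : List (Fin 4 → ℕ)} {D : List (Fin 4 → K)}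
    (h : ebarLeB q L B D = true) : RidgeBudget.ebar (evalT L) + B.length ≤ 4 := by
  simp only [ebarLeB, Bool.and_eq_true, decide_eq_true_eq, List.all_eq_true] at h
  obtain ⟨⟨⟨hordB, _⟩, hdeg⟩, hdual⟩ := h
  have hord := ordZero_of_ordB hordB
  set A := additiveSubspace (initialForm (evalT L)) with hA
  set Λ := rowMap L B with hΛ
  -- `A ≤ ker Λ`
  have hle : A ≤ LinearMap.ker Λ := by
    intro v hv
    rw [LinearMap.mem_ker]
    funext i
    rw [hΛ, rowMap_apply, Pi.zero_apply]
    have hβ : (StepKit.expo (B.get i)).degree + 1 = q := by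
      rw [degree_expo]; exact hdeg (B.get i) (List.get_mem B i)
    have := (mem_additiveSubspace_iff_polarRow hord v).mp hv (StepKit.expo (B.get i)) hβ
    rwa [coe_expo] at this
  -- `Λ` is surjective (dual family)
  have hsurj : LinearMap.range Λ = ⊤ := by
    rw [eq_top_iff]
    rintro t -
    refine ⟨∑ j, t j • D.getD j 0, ?_⟩
    funext i
    rw [map_sum, Finset.sum_apply]
    have hterm : ∀ j, (Λ (t j • D.getD j 0)) i = if i = j then t j else 0 := fun j => by
      rw [LinearMap.map_smul, Pi.smul_apply, smul_eq_mul, hΛ, rowMap_apply, hdual i j]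
      split_ifs <;> simp
    simp only [hterm, Finset.sum_ite_eq, Finset.mem_univ, if_true]
  -- rank–nullity
  have hrn := LinearMap.finrank_range_add_finrank_ker Λ
  rw [hsurj, finrank_top, Module.finrank_fintype_fun_eq_card, Fintype.card_fin] at hrn
  have hdom : Module.finrank K (Fin 4 → K) = 4 := by
    rw [Module.finrank_fintype_fun_eq_card, Fintype.card_fin]
  have hmono := Submodule.finrank_mono hle
  unfold RidgeBudget.ebar
  rw [← hA]
  omega

/-- **Exact `ē` from the two certificates.** [folklore] -/
theorem ebar_eq_of_certs {q : ℕ} {L : Terms 4 K} {V W : List (Fin 4 → K)} {B : List (Fin 4 → ℕ)}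
    {D : List (Fin 4 → K)} (h1 : ebarGeB q L V W = true) (h2 : ebarLeB q L B D = true)
    (hk : V.length + B.length = 4) : RidgeBudget.ebar (evalT L) = V.length := by
  have := length_le_ebar_of_ebarGeB h1
  have := ebar_add_length_le_of_ebarLeB h2
  omega

/-! ## §4 Acceptance rows: `ē` along the H1 chain of res-dim4-p-12 g2's `HeightBudgetFalse` (crit-4's specimen
that killed (H)): `2, 1, 1, 1, 1, 0` — one wide edge, then the narrow staircase of `RidgeBudget.narrowDrop`, ending
at `ē = 0` where `μ⁺ = 1` -/

/-- `ē(c0) = 2` on H1 (`HeightBudgetFalse.L0`). [OURS · ‖ K] -/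
theorem ebar_H1_0 : RidgeBudget.ebar (evalT HeightBudgetFalse.L0) = 2 :=
  ebar_eq_of_certs (q := 3) (V := [![1, 0, 0, 0], ![0, 1, 0, 0]]) (W := [![1, 0, 0, 0], ![0, 1, 0, 0]])
    (B := [![0, 0, 0, 2], ![0, 0, 1, 1]]) (D := [![0, 0, 1, 2], ![0, 0, 0, 2]])
    (by decide +kernel) (by decide +kernel) rfl

/-- `ē(c1) = 1` on H1 (`HeightBudgetFalse.L1`). [OURS · ‖ K] -/
theorem ebar_H1_1 : RidgeBudget.ebar (evalT HeightBudgetFalse.L1) = 1 :=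
  ebar_eq_of_certs (q := 3) (V := [![0, 1, 0, 0]]) (W := [![0, 1, 0, 0]])
    (B := [![0, 0, 0, 2], ![0, 0, 1, 1], ![0, 0, 2, 0]]) (D := [![2, 0, 1, 0], ![2, 0, 0, 0], ![2, 0, 0, 1]])
    (by decide +kernel) (by decide +kernel) rfl

/-- `ē(c2) = 1` on H1 (`HeightBudgetFalse.L2`). [OURS · ‖ K] -/
theorem ebar_H1_2 : RidgeBudget.ebar (evalT HeightBudgetFalse.L2) = 1 :=
  ebar_eq_of_certs (q := 3) (V := [![0, 1, 0, 0]]) (W := [![0, 1, 0, 0]])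
    (B := [![0, 0, 0, 2], ![0, 0, 1, 1], ![0, 0, 2, 0]]) (D := [![2, 0, 1, 0], ![2, 0, 0, 0], ![2, 0, 0, 1]])
    (by decide +kernel) (by decide +kernel) rfl

/-- `ē(c3) = 1` on H1 (`HeightBudgetFalse.L3`). [OURS · ‖ K] -/
theorem ebar_H1_3 : RidgeBudget.ebar (evalT HeightBudgetFalse.L3) = 1 :=
  ebar_eq_of_certs (q := 3) (V := [![0, 1, 0, 0]]) (W := [![0, 1, 0, 0]])
    (B := [![0, 0, 0, 2], ![0, 0, 1, 1], ![0, 0, 2, 0]]) (D := [![2, 0, 1, 0], ![2, 0, 0, 0], ![2, 0, 0, 1]])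
    (by decide +kernel) (by decide +kernel) rfl

/-- `ē(c4) = 1` on H1 (`HeightBudgetFalse.L4`). [OURS · ‖ K] -/
theorem ebar_H1_4 : RidgeBudget.ebar (evalT HeightBudgetFalse.L4) = 1 :=
  ebar_eq_of_certs (q := 3) (V := [![0, 1, 0, 0]]) (W := [![0, 1, 0, 0]])
    (B := [![0, 0, 0, 2], ![0, 0, 1, 1], ![0, 0, 2, 0]]) (D := [![2, 0, 1, 0], ![2, 0, 0, 0], ![2, 0, 0, 1]])
    (by decide +kernel) (by decide +kernel) rfl

/-- `ē(c5) = 0` on H1 (`HeightBudgetFalse.L5`). [OURS · ‖ K] -/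
theorem ebar_H1_5 : RidgeBudget.ebar (evalT HeightBudgetFalse.L5) = 0 :=
  ebar_eq_of_certs (q := 3) (V := []) (W := [])
    (B := [![0, 0, 0, 2], ![0, 0, 1, 1], ![0, 0, 2, 0], ![2, 0, 0, 0]]) (D := [![2, 0, 1, 0], ![2, 0, 0, 0], ![2, 0, 0, 1], ![0, 1, 0, 0]])
    (by decide +kernel) (by decide +kernel) rfl

end EbarCert

end Summit.ResolutionOfSingularities.ResolutionOfSingularities.Theorems.PIDim4

end
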